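import Summits.QuantumAdvantage.QuantumAdvantage.Theorems.CubicForrelationNearExactIsExactTwelveOddWeightLight

/-!
# Crux `CubicForrelation.NearExactIsExact` (stmt-QuantumAdvantage-14043) — the cubic form of a PRODUCT OF THREE AFFINE FUNCTIONS is the
  wedge of their linear parts

Certificate seat `b2b-cforr-cert` (gen 41).  HONEST FRAMING: a kernel-checked identity (standard axioms) — the third difference of
`f = [⟨y,z₁⟩ = b₁]·[⟨y,z₂⟩ = b₂]·[⟨y,z₃⟩ = b₃]` along `u, v, w` is `Σ_{π ∈ S₃} ⟨u,z_{π1}⟩⟨v,z_{π2}⟩⟨w,z_{π3}⟩` (in `𝔽₂`), at every base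
point.  With …KtThreeExceptionalStructure (`kte_exceptional_structure`: the exceptional light cell is `l₁l₂l₃ ⊕ g`, `g` the indicator of a
codimension-3 flat) and …CubicFormAnnihilator (the flat as three parity equations) this gives the cubic form `T ⊕ T′ = z₁∧z₂∧z₃ ⊕ z₄∧z₅∧z₆`
of the exceptional descendant (Lean roadmap for `E1280-even`, HOME/b2b-cforr-cert-g41/LEAN-TOOLS-GEN41.md).  Nothing about `θ₁₂`;
NOT summit progress.

* `tct3_third_triple_product`: the identity above (parities written `decide (Odd #{j | y j ∧ z j})` as everywhere in the tree).

References: folklore (Boolean derivatives of a cubic monomial).  Axioms: the standard three.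
-/

set_option linter.dupNamespace false -- D-0017: single-problem summit ⇒ `QuantumAdvantage.QuantumAdvantage` by design

namespace Summit.QuantumAdvantage.QuantumAdvantage.Theorems.CubicForrelation.NearExactIsExact

open Finset
open Literature.Computability.QuantumComplexity.BuzetChailloux (bxor zeroVec)

variable {n : ℕ}

/-- **Third difference of a product of three affine functions** = the alternating (here: symmetric, characteristic two) trilinear form
`Σ_{π ∈ S₃} ⟨u,z_{π1}⟩⟨v,z_{π2}⟩⟨w,z_{π3}⟩` of the linear parts; independent of the base point and of the constants `bᵢ`. [folklore] -/
theorem tct3_third_triple_product (z₁ z₂ z₃ : Fin n → Bool) (b₁ b₂ b₃ : Bool) (u v w x : Fin n → Bool) :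
    let f : (Fin n → Bool) → Bool := fun y =>
      (decide (decide (Odd #(univ.filter fun j => y j && z₁ j)) = b₁) &&
        decide (decide (Odd #(univ.filter fun j => y j && z₂ j)) = b₂)) &&
        decide (decide (Odd #(univ.filter fun j => y j && z₃ j)) = b₃)
    (((f x ^^ f (bxor x w)) ^^ (f (bxor x v) ^^ f (bxor (bxor x v) w))) ^^
        ((f (bxor x u) ^^ f (bxor (bxor x u) w)) ^^ (f (bxor (bxor x u) v) ^^ f (bxor (bxor (bxor x u) v) w)))) =
      ((((decide (Odd #(univ.filter fun j => u j && z₁ j)) &&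
            (decide (Odd #(univ.filter fun j => v j && z₂ j)) && decide (Odd #(univ.filter fun j => w j && z₃ j)))) ^^
          (decide (Odd #(univ.filter fun j => u j && z₁ j)) &&
            (decide (Odd #(univ.filter fun j => v j && z₃ j)) && decide (Odd #(univ.filter fun j => w j && z₂ j))))) ^^
        ((decide (Odd #(univ.filter fun j => u j && z₂ j)) &&
            (decide (Odd #(univ.filter fun j => v j && z₁ j)) && decide (Odd #(univ.filter fun j => w j && z₃ j)))) ^^
          (decide (Odd #(univ.filter fun j => u j && z₂ j)) &&
            (decide (Odd #(univ.filter fun j => v j && z₃ j)) && decide (Odd #(univ.filter fun j => w j && z₁ j)))))) ^^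
        ((decide (Odd #(univ.filter fun j => u j && z₃ j)) &&
            (decide (Odd #(univ.filter fun j => v j && z₁ j)) && decide (Odd #(univ.filter fun j => w j && z₂ j)))) ^^
          (decide (Odd #(univ.filter fun j => u j && z₃ j)) &&
            (decide (Odd #(univ.filter fun j => v j && z₂ j)) && decide (Odd #(univ.filter fun j => w j && z₁ j)))))) := by
  intro f
  -- parities of the eight points
  simp only [f, tow_parity_bxor]
  generalize decide (Odd #(univ.filter fun j => x j && z₁ j)) = X₁
  generalize decide (Odd #(univ.filter fun j => x j && z₂ j)) = X₂
  generalize decide (Odd #(univ.filter fun j => x j && z₃ j)) = X₃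
  generalize decide (Odd #(univ.filter fun j => u j && z₁ j)) = U₁
  generalize decide (Odd #(univ.filter fun j => u j && z₂ j)) = U₂
  generalize decide (Odd #(univ.filter fun j => u j && z₃ j)) = U₃
  generalize decide (Odd #(univ.filter fun j => v j && z₁ j)) = V₁
  generalize decide (Odd #(univ.filter fun j => v j && z₂ j)) = V₂
  generalize decide (Odd #(univ.filter fun j => v j && z₃ j)) = V₃
  generalize decide (Odd #(univ.filter fun j => w j && z₁ j)) = W₁
  generalize decide (Odd #(univ.filter fun j => w j && z₂ j)) = W₂
  generalize decide (Odd #(univ.filter fun j => w j && z₃ j)) = W₃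
  -- absorb the constants: `[X ⊕ T = b] = [X = b] ⊕ T`
  have hab : ∀ (X T b : Bool), decide ((X ^^ T) = b) = (decide (X = b) ^^ T) := by decide
  simp only [hab]
  generalize decide (X₁ = b₁) = A₁
  generalize decide (X₂ = b₂) = A₂
  generalize decide (X₃ = b₃) = A₃
  revert A₁ A₂ A₃ U₁ U₂ U₃ V₁ V₂ V₃ W₁ W₂ W₃
  decide

end Summit.QuantumAdvantage.QuantumAdvantage.Theorems.CubicForrelation.NearExactIsExact
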